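import Mathlib
import HarnessLib
import Literature.MathematicalPhysics.QuantumFieldTheory.ConstructiveQFTWave0
import Literature.MathematicalPhysics.QuantumLattice.AbelianFieldTensor
import Literature.MathematicalPhysics.QuantumLattice.AbelianMagneticFlux
import Summits.Ventures.LatticeQCDFlow.Scaling.FluxSectorCollar
import Summits.Ventures.LatticeQCDFlow.Scaling.SliceTwistWitness
import Summits.Ventures.LatticeQCDFlow.Scaling.BoxPeel
import Summits.Ventures.LatticeQCDFlow.Scaling.ThinPairs
import Summits.Ventures.LatticeQCDFlow.Scaling.RowFields

/-!
# LatticeQCDFlow / Scaling — the box spread: a charge-one configuration supported on an `l`-box with all plaquettes at angle `2π/((l-1)(l+3))` (v3.6, (C7b″) sharp form, part 4 of 4)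

HONEST FRAMING: exact (Metropolis-corrected) sampling algorithms for lattice gauge theory; figures
of merit are autocorrelation/cost numbers at stated couplings and volumes; no continuum-physics
claim.

THEORY-2.md §4 (C7(b″)), §5.17.  `U(1) = Circle`, `d = 2`, torus `(ℤ/L)²`, `2 ≤ l`, `l + 1 ≤ L`;
update set = the BLOCK `boxLinks 1 l` of `BoxPeel.lean` (all links with both endpoints in the
`l × l` box of sites `{1,…,l}²`; `2l(l-1)` links).

`BoxPeel.lean` proved a block tunnelling law by PEELING, at a threshold decaying geometrically in
`l`, and the strip winding showed that no law survives above `π/l`; this file SPREADS one unit of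
flux uniformly over every plaquette the block can touch: no law survives above `≍ 2π/l²`.
* **§1 (phases).**  Explicit link phases `hAng l a b` (direction `0`), `vAng l a b` (direction `1`),
  rational-linear in `π`, supported on the block, with lattice curl
  `α_l·[(a,b) ∈ R_l] - 2π·[(a,b) = (l,1)]`, `α_l = 2π/((l-1)(l+3))`, `R_l` = the
  `(l+1)² - 4 = (l-1)(l+3)` positions `{0,…,l}² ∖ corners` whose plaquette touches the block
  (`boxExponent_eq`, a `20`-case identity; the `-2π` is the one winding of the construction).
* **§2 (the box spread).**  `boxSpread l`, `= 1` off `boxLinks 1 l` (`boxSpread_eq_one_of_not_mem`),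
  plaquette `e^{iα_l}` on `R_l` and `1` elsewhere (`plaquetteHolonomy_boxSpread`), hence
  `2 sin(α_l/2)`-THIN (`dist_plaquetteHolonomy_boxSpread_le`) with FLUX CHARGE `#R_l·α_l/2π = 1`
  (`topCharge_boxSpread`).
* **§3 (necessity for blocks, power law).**  With the atom `1` (`ThinPairs.lean`): for every
  `c > 2 sin(π/((l-1)(l+3)))` (`≍ 2π/l²`) and every `C`, the flux law
  `(μ ⊗ κ){Q ≠ Q'} ≤ C·μ{∃ p, dist(U_p,1) ≥ c}` fails for some `μ`-invariant Markov pair moving only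
  `boxLinks 1 l` (`not_fluxLaw_boxLinks_spread`); likewise the `ε`-sector law,
  `2 sin(π/((l-1)(l+3))) < ε ≤ 2` (`not_sectorLaw_boxLinks_spread`).  Sufficiency
  (`BoxTouch.lean`: `compProd_topCharge_ne_le_of_links_maxPlaquette` with `#P ≤ (l-1)(l+3)`) sits
  at `2 sin(π/(2(l-1)(l+3)))`: the residual factor `2` is the unbalanced pair's, removed by
  balancing in `BoxSpreadPair.lean` (THEORY-2.md §5.17).
-/

noncomputable section

namespace Summit.Ventures.LatticeQCDFlow.Theory2.Lattice.Flux

open MeasureTheory ProbabilityTheory Metric Set Filter Topology Real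
open scoped ENNReal
open Literature.MathematicalPhysics.QuantumFieldTheory Literature.MathematicalPhysics.QuantumLattice

/-! ## §1. The phases and their curl -/

section Phases

/-- The spread angle `α_l = 2π/((l-1)(l+3))`: one unit of flux over `(l+1)² - 4` plaquettes. [folklore] -/
def boxAlpha (l : ℕ) : ℝ := 2 * π / (((l : ℝ) - 1) * ((l : ℝ) + 3))

/-- The row increment `D_l = -(l+1)α_l/(l-1)` of the horizontal phases. [folklore] -/
def boxD (l : ℕ) : ℝ := -(((l : ℝ) + 1) * boxAlpha l / ((l : ℝ) - 1))

/-- Horizontal phase on row `b` of the block (independent of the column). [folklore] -/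
def hPhase (l b : ℕ) : ℝ :=
  -boxAlpha l + ((b : ℝ) - 1) * boxD l + (if 2 ≤ b then 2 * π / ((l : ℝ) - 1) else 0)

/-- Vertical phase at column `a`, row `b` of the block. [folklore] -/
def vPhase (l a b : ℕ) : ℝ :=
  (a : ℝ) * boxAlpha l + ((a : ℝ) - 1) * (boxD l + if b = 1 then 2 * π / ((l : ℝ) - 1) else 0)

/-- Phase of the direction-`0` link at `(a, b)`: `hPhase` on the block's horizontal links
(`1 ≤ a ≤ l - 1`, `1 ≤ b ≤ l`), `0` elsewhere. [folklore] -/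
def hAng (l a b : ℕ) : ℝ := if 1 ≤ a ∧ a + 1 ≤ l ∧ 1 ≤ b ∧ b ≤ l then hPhase l b else 0

/-- Phase of the direction-`1` link at `(a, b)`: `vPhase` on the block's vertical links
(`1 ≤ a ≤ l`, `1 ≤ b ≤ l - 1`), `0` elsewhere. [folklore] -/
def vAng (l a b : ℕ) : ℝ := if 1 ≤ a ∧ a ≤ l ∧ 1 ≤ b ∧ b + 1 ≤ l then vPhase l a b else 0

/-- The TOUCHING REGION `R_l`: positions `(a, b) ∈ {0,…,l}²` other than the four corners — exactly
the plane positions whose plaquette contains a link of the block. [folklore] -/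
def inR (l a b : ℕ) : Prop := a ≤ l ∧ b ≤ l ∧ ¬((a = 0 ∨ a = l) ∧ (b = 0 ∨ b = l))
/-- `inR` is decidable (LANDING NOTE lean-1 GEN-5: docstring added for the gate lint). [folklore] -/
instance inR.decidable (l a b : ℕ) : Decidable (inR l a b) := by unfold inR; infer_instance

/-- The plaquette angle of the spread: `α_l` on `R_l`, `0` elsewhere. [folklore] -/
def boxF (l a b : ℕ) : ℝ := if inR l a b then boxAlpha l else 0

/-- The denominators `l - 1`, `l + 3` are non-zero (`2 ≤ l`). [folklore] -/
theorem boxDen_ne_zero {l : ℕ} (hl : 2 ≤ l) : (l : ℝ) - 1 ≠ 0 ∧ (l : ℝ) + 3 ≠ 0 := by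
  have : (2 : ℝ) ≤ l := by exact_mod_cast hl
  exact ⟨by linarith, by positivity⟩

/-- **The curl of the phases** (`2 ≤ l`): around the plaquette at `(a, b)`,
`hAng(a,b) + vAng(a+1,b) - hAng(a,b+1) - vAng(a,b) = α_l·[(a,b) ∈ R_l] - 2π·[(a,b) = (l,1)]`
(a `20`-case rational identity; the `-2π` is the single winding of the construction). [folklore] -/
theorem boxExponent_eq {l : ℕ} (hl : 2 ≤ l) (a b : ℕ) :
    hAng l a b + vAng l (a + 1) b - hAng l a (b + 1) - vAng l a b =
      boxF l a b - (if a = l ∧ b = 1 then 2 * π else 0) := by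
  obtain ⟨hl1, hl3⟩ := boxDen_ne_zero hl
  simp only [hAng, vAng, hPhase, vPhase, boxF, inR, boxAlpha, boxD]
  rcases (show a = 0 ∨ (1 ≤ a ∧ a + 1 ≤ l) ∨ a = l ∨ l + 1 ≤ a by omega) with ha | ha | ha | ha <;>
  rcases (show b = 0 ∨ b = 1 ∨ (2 ≤ b ∧ b + 1 ≤ l) ∨ b = l ∨ l + 1 ≤ b by omega)
    with hb | hb | hb | hb | hb <;>
  simp (disch := omega) only [if_pos, if_neg] <;>
  subst_vars <;> push_cast <;> (try field_simp) <;> ring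

/-- `α_l > 0`. [folklore] -/
theorem boxAlpha_pos {l : ℕ} (hl : 2 ≤ l) : 0 < boxAlpha l := by
  have : (2 : ℝ) ≤ l := by exact_mod_cast hl
  unfold boxAlpha
  exact div_pos (by positivity) (mul_pos (by linarith) (by linarith))

/-- `α_l ≤ 2π/5 < π`. [folklore] -/
theorem boxAlpha_lt_pi {l : ℕ} (hl : 2 ≤ l) : boxAlpha l < π := by
  have h2 : (2 : ℝ) ≤ l := by exact_mod_cast hl
  have h5 : (5 : ℝ) ≤ ((l : ℝ) - 1) * ((l : ℝ) + 3) := by nlinarith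
  unfold boxAlpha
  rw [div_lt_iff₀ (by positivity)]
  nlinarith [Real.pi_pos]

/-- `0 ≤ boxF`. [folklore] -/
theorem boxF_nonneg {l : ℕ} (hl : 2 ≤ l) (a b : ℕ) : 0 ≤ boxF l a b := by
  unfold boxF
  split_ifs
  · exact (boxAlpha_pos hl).le
  · exact le_rfl

/-- `boxF ≤ α_l`. [folklore] -/
theorem boxF_le {l : ℕ} (hl : 2 ≤ l) (a b : ℕ) : boxF l a b ≤ boxAlpha l := by
  unfold boxF
  split_ifs
  · exact le_rfl
  · exact (boxAlpha_pos hl).le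

/-- `|boxF| ≤ α_l`. [folklore] -/
theorem abs_boxF_le {l : ℕ} (hl : 2 ≤ l) (a b : ℕ) : |boxF l a b| ≤ boxAlpha l := by
  rw [abs_of_nonneg (boxF_nonneg hl a b)]
  exact boxF_le hl a b

/-- `boxF` vanishes outside `{0,…,l}²`. [folklore] -/
theorem boxF_eq_zero_of_lt {l a b : ℕ} (h : l < a ∨ l < b) : boxF l a b = 0 := by
  unfold boxF inR
  rw [if_neg]
  omega

/-- On `{0,…,l}²`, `boxF = α_l(1 - c_a c_b)` with the corner indicators `c`. [folklore] -/
theorem boxF_eq_of_le {l a b : ℕ} (ha : a ≤ l) (hb : b ≤ l) :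
    boxF l a b = boxAlpha l -
      boxAlpha l * ((if a = 0 ∨ a = l then (1 : ℝ) else 0) * (if b = 0 ∨ b = l then (1 : ℝ) else 0)) := by
  unfold boxF inR
  by_cases h1 : a = 0 ∨ a = l <;> by_cases h2 : b = 0 ∨ b = l
  · rw [if_neg (fun h => h.2.2 ⟨h1, h2⟩), if_pos h1, if_pos h2]; ring
  · rw [if_pos ⟨ha, hb, fun h => h2 h.2⟩, if_pos h1, if_neg h2]; ring
  · rw [if_pos ⟨ha, hb, fun h => h1 h.1⟩, if_neg h1, if_pos h2]; ring
  · rw [if_pos ⟨ha, hb, fun h => h1 h.1⟩, if_neg h1, if_neg h2]; ring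

/-- The corner indicators on `{0,…,l}` sum to `2` (`l ≠ 0`). [folklore] -/
theorem sum_cornerInd {l : ℕ} (hl : 2 ≤ l) :
    ∑ i ∈ Finset.range (l + 1), (if i = 0 ∨ i = l then (1 : ℝ) else 0) = 2 := by
  rw [Finset.sum_boole]
  have : (Finset.range (l + 1)).filter (fun i => i = 0 ∨ i = l) = {0, l} := by
    ext i
    simp only [Finset.mem_filter, Finset.mem_range, Finset.mem_insert, Finset.mem_singleton]
    omega
  rw [this, Finset.card_pair (by omega)]
  norm_num

/-- **The spread carries total angle `2π`**: `Σ_{a,b < L} boxF l a b = ((l+1)² - 4)·α_l = 2π`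
(`l + 1 ≤ L`). [folklore] -/
theorem sum_boxF {l L : ℕ} (hl : 2 ≤ l) (hlL : l + 1 ≤ L) :
    ∑ i ∈ Finset.range L, ∑ j ∈ Finset.range L, boxF l i j = 2 * π := by
  obtain ⟨hl1, hl3⟩ := boxDen_ne_zero hl
  have hsub : Finset.range (l + 1) ⊆ Finset.range L := Finset.range_subset_range.mpr hlL
  have hin : ∀ i, ∑ j ∈ Finset.range L, boxF l i j = ∑ j ∈ Finset.range (l + 1), boxF l i j := by
    intro i
    refine (Finset.sum_subset hsub fun j hj hj' => ?_).symm
    rw [Finset.mem_range] at hj hj'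
    exact boxF_eq_zero_of_lt (Or.inr (by omega))
  have hout : ∑ i ∈ Finset.range L, ∑ j ∈ Finset.range (l + 1), boxF l i j =
      ∑ i ∈ Finset.range (l + 1), ∑ j ∈ Finset.range (l + 1), boxF l i j := by
    refine (Finset.sum_subset hsub fun i hi hi' => ?_).symm
    rw [Finset.mem_range] at hi hi'
    exact Finset.sum_eq_zero fun j _ => boxF_eq_zero_of_lt (Or.inl (by omega))
  simp only [hin]
  rw [hout]
  have hc := sum_cornerInd hl
  calc ∑ i ∈ Finset.range (l + 1), ∑ j ∈ Finset.range (l + 1), boxF l i j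
      = ∑ i ∈ Finset.range (l + 1), ∑ j ∈ Finset.range (l + 1), (boxAlpha l -
          boxAlpha l * ((if i = 0 ∨ i = l then (1 : ℝ) else 0) *
            (if j = 0 ∨ j = l then (1 : ℝ) else 0))) := by
        refine Finset.sum_congr rfl fun i hi => Finset.sum_congr rfl fun j hj => ?_
        rw [Finset.mem_range] at hi hj
        exact boxF_eq_of_le (by omega) (by omega)
    _ = ∑ i ∈ Finset.range (l + 1), ((l + 1) * boxAlpha l -
          boxAlpha l * (if i = 0 ∨ i = l then (1 : ℝ) else 0) * 2) := by
        refine Finset.sum_congr rfl fun i _ => ?_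
        rw [Finset.sum_sub_distrib, Finset.sum_const, Finset.card_range, nsmul_eq_mul,
          ← Finset.mul_sum, ← Finset.mul_sum, hc]
        push_cast
        ring
    _ = (l + 1) * ((l + 1) * boxAlpha l) - boxAlpha l * 2 * 2 := by
        rw [Finset.sum_sub_distrib, Finset.sum_const, Finset.card_range, nsmul_eq_mul,
          ← Finset.sum_mul, ← Finset.mul_sum, hc]
        push_cast
        ring
    _ = 2 * π := by
        unfold boxAlpha
        field_simp
        ring

end Phases

/-! ## §2. The box spread -/

section Spread

variable {L : ℕ} [NeZero L] {l : ℕ}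

/-- **The box spread**: direction-`0` links carry `e^{i hAng}`, direction-`1` links `e^{i vAng}`,
read off the representatives `((x 0).val, (x 1).val)`. [folklore] -/
def boxSpread (l : ℕ) : GaugeConfig 2 L Circle := fun e =>
  if e.2 = 0 then Circle.exp (hAng l (e.1 0).val (e.1 1).val)
  else Circle.exp (vAng l (e.1 0).val (e.1 1).val)

omit [NeZero L] in
/-- Horizontal links of the spread. [folklore] -/
theorem boxSpread_horiz (l : ℕ) (x : Site 2 L) :
    boxSpread l (x, 0) = Circle.exp (hAng l (x 0).val (x 1).val) := if_pos rfl

omit [NeZero L] in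
/-- Vertical links of the spread. [folklore] -/
theorem boxSpread_vert (l : ℕ) (x : Site 2 L) :
    boxSpread l (x, 1) = Circle.exp (vAng l (x 0).val (x 1).val) :=
  if_neg (show (1 : Fin 2) ≠ 0 by decide)

/-- **The plaquettes of the box spread** (`2 ≤ l`, `l + 1 ≤ L`): `e^{iα_l}` on the touching
region, `1` elsewhere — i.e. `e^{i boxF}`. [folklore] -/
theorem plaquetteHolonomy_boxSpread (hl : 2 ≤ l) (hlL : l + 1 ≤ L) (x : Site 2 L) :
    plaquetteHolonomy (boxSpread l) x 0 1 = Circle.exp (boxF l (x 0).val (x 1).val) := by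
  haveI : Fact (1 < L) := ⟨by omega⟩
  have haL : (x 0).val < L := ZMod.val_lt _
  have hbL : (x 1).val < L := ZMod.val_lt _
  have h00 : (x.shift 0) 0 = x 0 + 1 ∧ (x.shift 0) 1 = x 1 := by constructor <;> simp [Site.shift]
  have h11 : (x.shift 1) 0 = x 0 ∧ (x.shift 1) 1 = x 1 + 1 := by constructor <;> simp [Site.shift]
  have hv : vAng l (x 0 + 1).val (x 1).val = vAng l ((x 0).val + 1) (x 1).val := by
    rw [val_add_one_eq]
    split_ifs with h
    · unfold vAng; rw [if_neg (by omega), if_neg (by omega)]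
    · rfl
  have hh : hAng l (x 0).val (x 1 + 1).val = hAng l (x 0).val ((x 1).val + 1) := by
    rw [val_add_one_eq]
    split_ifs with h
    · unfold hAng; rw [if_neg (by omega), if_neg (by omega)]
    · rfl
  rw [plaquetteHolonomy, boxSpread_horiz, boxSpread_vert, boxSpread_horiz, boxSpread_vert, h00.1,
    h00.2, h11.1, h11.2, hv, hh, ← Circle.exp_neg, ← Circle.exp_neg, ← Circle.exp_add, ← Circle.exp_add,
    ← Circle.exp_add]
  have hE : hAng l (x 0).val (x 1).val + vAng l ((x 0).val + 1) (x 1).val +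
      -hAng l (x 0).val ((x 1).val + 1) + -vAng l (x 0).val (x 1).val =
      boxF l (x 0).val (x 1).val - (if (x 0).val = l ∧ (x 1).val = 1 then 2 * π else 0) := by
    rw [← boxExponent_eq hl]; ring
  rw [hE]
  split_ifs
  · exact Circle.exp_sub_two_pi _
  · rw [sub_zero]

/-- The field tensor of the box spread is `boxF`. [folklore] -/
theorem abelianFieldTensor_boxSpread (hl : 2 ≤ l) (hlL : l + 1 ≤ L) (x : Site 2 L) :
    abelianFieldTensor (boxSpread l) x 0 1 = boxF l (x 0).val (x 1).val := by
  have := boxF_nonneg hl (x 0).val (x 1).val; have := boxF_le hl (x 0).val (x 1).val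
  exact abelianFieldTensor_eq_of_plaquette_eq_exp (plaquetteHolonomy_boxSpread hl hlL x)
    (by linarith [Real.pi_pos]) (by linarith [boxAlpha_lt_pi hl])

/-- **The box spread is `2 sin(π/((l-1)(l+3)))`-thin** (`= 2 sin(α_l/2)`). [folklore] -/
theorem dist_plaquetteHolonomy_boxSpread_le (hl : 2 ≤ l) (hlL : l + 1 ≤ L) (p : Plaquette 2 L) :
    dist (plaquetteHolonomy (boxSpread l) p.1 p.2.1.1 p.2.1.2) 1 ≤
      2 * Real.sin (π / (((l : ℝ) - 1) * ((l : ℝ) + 3))) := by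
  have h := dist_plaquette_le_of_eq_exp (plaquetteHolonomy_boxSpread hl hlL)
    (fun x => abs_boxF_le hl (x 0).val (x 1).val) (boxAlpha_lt_pi hl).le p
  rwa [show boxAlpha l / 2 = π / (((l : ℝ) - 1) * ((l : ℝ) + 3)) by unfold boxAlpha; ring] at h

/-- **The box spread has flux charge `1`.** [folklore] -/
theorem topCharge_boxSpread (hl : 2 ≤ l) (hlL : l + 1 ≤ L) :
    topCharge (0 : Site 2 L) 0 1 (boxSpread l) = 1 := by
  have hc0 : ∀ s t : ZMod L,
      ((0 : Site 2 L) + Pi.single (0 : Fin 2) s + Pi.single (1 : Fin 2) t : Site 2 L) 0 = s ∧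
      ((0 : Site 2 L) + Pi.single (0 : Fin 2) s + Pi.single (1 : Fin 2) t : Site 2 L) 1 = t := by
    intro s t; constructor <;> simp
  unfold topCharge magneticFlux
  simp only [abelianFieldTensor_boxSpread hl hlL, (hc0 _ _).1, (hc0 _ _).2]
  have hinner : ∀ s : ZMod L, ∑ t : ZMod L, boxF l s.val t.val =
      ∑ j ∈ Finset.range L, boxF l s.val j := fun s => sum_zmod_val (boxF l s.val)
  simp only [hinner]
  rw [sum_zmod_val (fun i => ∑ j ∈ Finset.range L, boxF l i j), sum_boxF hl hlL]
  field_simp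

/-- Box coordinates relative to the corner `1 = (1,1)`: `coord 1 x j = (x j).val - 1` when
`(x j).val ≥ 1`. [folklore] -/
theorem coord_one_eq [Fact (1 < L)] (x : Site 2 L) (j : Fin 2) (h : 1 ≤ (x j).val) :
    coord (1 : Site 2 L) x j = (x j).val - 1 := by
  unfold coord
  rw [Pi.sub_apply, Pi.one_apply, ZMod.val_sub (by rw [ZMod.val_one]; exact h), ZMod.val_one]

/-- **The box spread is supported on the block** `boxLinks 1 l`. [folklore] -/
theorem boxSpread_eq_one_of_not_mem (hl : 2 ≤ l) (hlL : l + 1 ≤ L) {e : Edge 2 L}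
    (he : e ∉ boxLinks (1 : Site 2 L) l) : boxSpread l e = 1 := by
  haveI : Fact (1 < L) := ⟨by omega⟩
  obtain ⟨x, i⟩ := e
  have hi : i = 0 ∨ i = 1 := by fin_cases i <;> simp
  rcases hi with rfl | rfl
  · rw [boxSpread_horiz, hAng]
    split_ifs with h
    · exfalso
      apply he
      rw [boxLinks, Set.mem_setOf_eq]
      refine ⟨fun j => ?_, ?_⟩
      · have hj : j = 0 ∨ j = 1 := by fin_cases j <;> simp
        rcases hj with rfl | rfl
        · rw [coord_one_eq x 0 h.1]; omega
        · rw [coord_one_eq x 1 h.2.2.1]; omega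
      · show coord (1 : Site 2 L) x 0 + 1 < l
        rw [coord_one_eq x 0 h.1]; omega
    · exact Circle.exp_zero
  · rw [boxSpread_vert, vAng]
    split_ifs with h
    · exfalso
      apply he
      rw [boxLinks, Set.mem_setOf_eq]
      refine ⟨fun j => ?_, ?_⟩
      · have hj : j = 0 ∨ j = 1 := by fin_cases j <;> simp
        rcases hj with rfl | rfl
        · rw [coord_one_eq x 0 h.1]; omega
        · rw [coord_one_eq x 1 h.2.2.1]; omega
      · show coord (1 : Site 2 L) x 1 + 1 < l
        rw [coord_one_eq x 1 h.2.2.1]; omega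
    · exact Circle.exp_zero

end Spread

/-! ## §3. Necessity for block updates: no law above `2 sin(π/((l-1)(l+3)))` -/

section Necessity

variable {L : ℕ} [NeZero L] {l : ℕ}

omit [NeZero L] in
/-- The trivial configuration is below the box threshold: `0 < c` whenever
`2 sin(π/((l-1)(l+3))) < c`. [folklore] -/
theorem dist_plaquetteHolonomy_one_lt [NeZero L] (hl : 2 ≤ l) {c : ℝ}
    (hc : 2 * Real.sin (π / (((l : ℝ) - 1) * ((l : ℝ) + 3))) < c) (p : Plaquette 2 L) :
    dist (plaquetteHolonomy (1 : GaugeConfig 2 L Circle) p.1 p.2.1.1 p.2.1.2) 1 < c := by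
  have h := boxAlpha_pos hl
  have h' := boxAlpha_lt_pi hl
  rw [plaquetteHolonomy_one', dist_self]
  rw [show π / (((l : ℝ) - 1) * ((l : ℝ) + 3)) = boxAlpha l / 2 by unfold boxAlpha; ring] at hc
  linarith [Real.sin_nonneg_of_nonneg_of_le_pi (by linarith : 0 ≤ boxAlpha l / 2) (by linarith)]

/-- **NO FLUX LAW FOR A BLOCK UPDATE ABOVE `2 sin(π/((l-1)(l+3)))`** (`2 ≤ l`, `l + 1 ≤ L`): for
every `c > 2 sin(π/((l-1)(l+3)))` and every constant `C`, the law
`(μ ⊗ κ){Q ≠ Q'} ≤ C·μ{∃ p, dist(U_p,1) ≥ c}` fails for some `μ`-invariant Markov pair moving only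
`boxLinks 1 l` (atoms `1` and `boxSpread l`).  Power law `≍ 2π/l²` in place of the geometric
threshold of `BoxPeel.lean`. [folklore] -/
theorem not_fluxLaw_boxLinks_spread (hl : 2 ≤ l) (hlL : l + 1 ≤ L) {c : ℝ}
    (hc : 2 * Real.sin (π / (((l : ℝ) - 1) * ((l : ℝ) + 3))) < c) (C : ℝ≥0∞) :
    ¬ ∀ (μ : Measure (GaugeConfig 2 L Circle)) [IsProbabilityMeasure μ]
        (κ : Kernel (GaugeConfig 2 L Circle) (GaugeConfig 2 L Circle)) [IsMarkovKernel κ],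
        κ.Invariant μ → (∀ᵐ q ∂(μ ⊗ₘ κ), ∀ e ∉ boxLinks (1 : Site 2 L) l, q.1 e = q.2 e) →
        (μ ⊗ₘ κ) {q | topCharge (0 : Site 2 L) 0 1 q.1 ≠ topCharge (0 : Site 2 L) 0 1 q.2} ≤
          C * μ {W | ∃ p : Plaquette 2 L,
            c ≤ dist (plaquetteHolonomy W p.1 p.2.1.1 p.2.1.2) 1} :=
  not_fluxLaw_of_two (U := 1) (V := boxSpread l)
    (fun _ he => by rw [Pi.one_apply, boxSpread_eq_one_of_not_mem hl hlL he])
    (not_mem_thick_of_thin (dist_plaquetteHolonomy_one_lt hl hc))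
    (not_mem_thick_of_thin fun p => (dist_plaquetteHolonomy_boxSpread_le hl hlL p).trans_lt hc)
    (by rw [topCharge_one', topCharge_boxSpread hl hlL]; norm_num) C

/-- **NO `ε`-SECTOR LAW FOR A BLOCK UPDATE ABOVE `2 sin(π/((l-1)(l+3)))`**
(`2 sin(π/((l-1)(l+3))) < ε ≤ 2`, `c > 2 sin(π/((l-1)(l+3)))`, any `C`). [folklore] -/
theorem not_sectorLaw_boxLinks_spread (hl : 2 ≤ l) (hlL : l + 1 ≤ L) {c ε : ℝ}
    (hc : 2 * Real.sin (π / (((l : ℝ) - 1) * ((l : ℝ) + 3))) < c)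
    (hε : 2 * Real.sin (π / (((l : ℝ) - 1) * ((l : ℝ) + 3))) < ε) (hε2 : ε ≤ 2) (C : ℝ≥0∞) :
    ¬ ∀ (μ : Measure (GaugeConfig 2 L Circle)) [IsProbabilityMeasure μ]
        (κ : Kernel (GaugeConfig 2 L Circle) (GaugeConfig 2 L Circle)) [IsMarkovKernel κ],
        κ.Invariant μ → (∀ᵐ q ∂(μ ⊗ₘ κ), ∀ e ∉ boxLinks (1 : Site 2 L) l, q.1 e = q.2 e) →
        (μ ⊗ₘ κ) {q | connectedComponentIn (Thin L ε) q.1 ≠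
            connectedComponentIn (Thin L ε) q.2} ≤
          C * μ {W | ∃ p : Plaquette 2 L,
            c ≤ dist (plaquetteHolonomy W p.1 p.2.1.1 p.2.1.2) 1} :=
  not_sectorLaw_of_two (U := 1) (V := boxSpread l)
    (fun _ he => by rw [Pi.one_apply, boxSpread_eq_one_of_not_mem hl hlL he])
    (not_mem_thick_of_thin (dist_plaquetteHolonomy_one_lt hl hc))
    (not_mem_thick_of_thin fun p => (dist_plaquetteHolonomy_boxSpread_le hl hlL p).trans_lt hc)
    (by rw [topCharge_one', topCharge_boxSpread hl hlL]; norm_num)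
    (dist_plaquetteHolonomy_one_lt hl hε)
    (fun p => (dist_plaquetteHolonomy_boxSpread_le hl hlL p).trans_lt hε) hε2 C

end Necessity

end Summit.Ventures.LatticeQCDFlow.Theory2.Lattice.Flux
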